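import Literature.NumberTheory.EllipticCurves.CongruentNumberOne
import HarnessLib

/-!
# Crux `MazurKenkuBound` (stmt-ABC-15125), line `Sketch` — stub `stub_twoChainAlgebra`:
# the Diophantine end of "no rational cyclic `32`-isogeny"

A rational cyclic `32`-isogeny gives (stubs `stub_twoNormalize`, `stub_twoVertex`,
`stub_twoStep` of the line) a chain of three explicit `2`-isogenies between curves
`y² = x³ + aᵢx² + bᵢx` (`aᵢ₊₁ = aᵢ + 6eᵢ`, `bᵢ₊₁ = 4eᵢ(aᵢ + 2eᵢ)`), each `bᵢ` a square: rationals
`a₀, e₀, e₁, e₂, d₃` with `e₀e₁e₂ ≠ 0` and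

* `e₁² = 4e₀(a₀ + 2e₀)`, `e₂² = 4e₁(a₁ + 2e₁)`, `d₃² = 4e₂(a₂ + 2e₂)`
  (`a₁ = a₀ + 6e₀`, `a₂ = a₁ + 6e₁`), and `a₂² ≠ 4e₂²` (the level-`2` curve is nonsingular).

This file shows that there are none (pure algebra over `ℚ` plus Fermat):

1. `4e₀(a₁ + 2e₁) = (e₁ + 4e₀)²`, so `e₀e₂² = e₁(e₁ + 4e₀)²`; hence `e₁ + 4e₀ ≠ 0` and, with
   `x := e₂/(e₁ + 4e₀) ≠ 0`, `e₁ = e₀x²`, `e₂ = e₀x(x² + 4)`, `4a₀ = e₀(x⁴ − 8)`;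
2. then `4(a₂ ± 2e₂) = e₀(x ± 2)⁴`, so `a₂² ≠ 4e₂²` reads `x² ≠ 4`, and
   `d₃² = 4e₂(a₂ + 2e₂) = e₀²x(x² + 4)(x + 2)⁴`, i.e. `y := d₃/(e₀(x + 2)²)` is a rational point
   of `y² = x³ + 4x` (the curve `32A1`) with `x ∉ {0, 2, −2}`, so `y ≠ 0`;
3. its image `X = (x² + 4)/(4x)`, `Y = y(x² − 4)/(8x²)` under the `2`-isogeny to `Y² = X³ − X`
   (`32A2`) has `Y ≠ 0` — against Fermat: every rational point of `Y² = X³ − X` has `Y = 0`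
   (Knapp, *Elliptic Curves*, Cor. 4.22: `1` is not a congruent number; tree:
   `MestreOesterle.eq_zero_of_sq_eq_cube_sub_self`).

## References

* [Knapp1993] A. W. Knapp, *Elliptic Curves*, Mathematical Notes 40, Princeton University Press
  (1993), Cor. 4.22 (Fermat) and its proof (`y² = x³ − x` has rank `0`).
* [Kenku1982] M. A. Kenku, *On the number of ℚ-isomorphism classes of elliptic curves in each
  ℚ-isogeny class*, J. Number Theory 15 (1982) 199–202, proof of Thm. 1 (the level `32`).
-/

-- `Summit.ABC.ABC` is the mandated summit-side namespace (CONVENTIONS §2); the duplicate is deliberate.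
set_option linter.dupNamespace false

noncomputable section

open scoped Classical
open WeierstrassCurve
open Literature.NumberTheory.EllipticCurves

namespace Summit.ABC.ABC.Theorems

/-- The parametrised end: if `d₃² = e₀²x(x² + 4)(x + 2)⁴` with `e₀x ≠ 0` and `x² ≠ 4`, then
`y := d₃/(e₀(x + 2)²)` lies on `y² = x³ + 4x` with `y(x² − 4) ≠ 0`, and the `2`-isogenous point
`((x² + 4)/(4x), y(x² − 4)/(8x²))` of `Y² = X³ − X` has `Y ≠ 0`, contradicting Fermat
(`MestreOesterle.eq_zero_of_sq_eq_cube_sub_self`). [cite: Knapp1993, Cor. 4.22] -/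
private theorem false_of_sq_eq_twoChain {e₀ x d₃ : ℚ} (he₀ : e₀ ≠ 0) (hx0 : x ≠ 0)
    (hx4 : x ^ 2 - 4 ≠ 0) (hd : d₃ ^ 2 = e₀ ^ 2 * x * (x ^ 2 + 4) * (x + 2) ^ 4) : False := by
  have hxp : x + 2 ≠ 0 := fun h ↦ hx4 (by linear_combination (x - 2) * h)
  -- the rational point `(x, y)` of `y² = x³ + 4x`
  have hy2 : (d₃ / (e₀ * (x + 2) ^ 2)) ^ 2 = x ^ 3 + 4 * x := by
    rw [div_pow, hd]
    field_simp
  generalize d₃ / (e₀ * (x + 2) ^ 2) = y at hy2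
  have hy0 : y ≠ 0 := by
    rintro rfl
    have hx : x * (x ^ 2 + 4) = 0 := by linear_combination -hy2
    rcases mul_eq_zero.mp hx with h | h
    · exact hx0 h
    · nlinarith [sq_nonneg x]
  -- its image under the `2`-isogeny `y² = x³ + 4x → Y² = X³ − X`
  have hY : (y * (x ^ 2 - 4) / (8 * x ^ 2)) ^ 2 =
      ((x ^ 2 + 4) / (4 * x)) ^ 3 - (x ^ 2 + 4) / (4 * x) := by
    rw [div_pow, mul_pow, hy2]
    field_simp
    ring
  have h0 := MestreOesterle.eq_zero_of_sq_eq_cube_sub_self hY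
  rw [div_eq_zero_iff, mul_eq_zero] at h0
  rcases h0 with (h | h) | h
  · exact hy0 h
  · exact hx4 h
  · exact (mul_ne_zero (by norm_num) (pow_ne_zero 2 hx0)) h

/-- STUB 11 (the Diophantine end): the three vertex relations of a chain of length three have no
rational solution — with `x = e₂/(e₁ + 4e₀)` one gets `e₁ = e₀x²`, `e₂ = e₀x(x² + 4)`,
`4a₀ = e₀(x⁴ − 8)`, whence `d₃² = e₀²x(x² + 4)(x + 2)⁴`: `y² = x³ + 4x` for
`y = d₃/(e₀(x + 2)²)`, `x ∉ {0, ±2}`, and the `2`-isogenous point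
`((x² + 4)/(4x), y(x² − 4)/(8x²))` of `Y² = X³ − X` would have `Y ≠ 0`, against Fermat (tree:
`MestreOesterle.eq_zero_of_sq_eq_cube_sub_self`). (The nonvanishing of the level-`1`
discriminant, `(a₀ + 6e₀)² ≠ 4e₁²`, is not needed: it follows from the rest.)
[cite: Knapp1993, Cor. 4.22] -/
theorem stub_twoChainAlgebra :
    ∀ (a₀ e₀ e₁ e₂ d₃ : ℚ), e₀ ≠ 0 → e₁ ≠ 0 → e₂ ≠ 0 →
      e₁ ^ 2 = 4 * e₀ * (a₀ + 2 * e₀) →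
      e₂ ^ 2 = 4 * e₁ * (a₀ + 6 * e₀ + 2 * e₁) →
      d₃ ^ 2 = 4 * e₂ * (a₀ + 6 * e₀ + 6 * e₁ + 2 * e₂) →
      (a₀ + 6 * e₀) ^ 2 ≠ 4 * e₁ ^ 2 →
      (a₀ + 6 * e₀ + 6 * e₁) ^ 2 ≠ 4 * e₂ ^ 2 → False := by
  intro a₀ e₀ e₁ e₂ d₃ he₀ _ he₂ h₁ h₂ h₃ _ n₂
  -- (i) `e₀e₂² = e₁(e₁ + 4e₀)²`, so `e₁ + 4e₀ ≠ 0`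
  have hcl : e₀ * e₂ ^ 2 = e₁ * (e₁ + 4 * e₀) ^ 2 := by linear_combination e₀ * h₂ - e₁ * h₁
  have hs : e₁ + 4 * e₀ ≠ 0 := by
    intro hs
    have hne : e₀ * e₂ ^ 2 ≠ 0 := mul_ne_zero he₀ (pow_ne_zero 2 he₂)
    rw [hcl, hs] at hne
    exact hne (by ring)
  -- (ii)/(iii) `x := e₂/(e₁ + 4e₀)`: `e₁ = e₀x²`, `4a₀ = e₀(x⁴ − 8)`, `e₂ = e₀x(x² + 4)`
  obtain ⟨x, hx⟩ : ∃ x : ℚ, e₂ = x * (e₁ + 4 * e₀) :=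
    ⟨e₂ / (e₁ + 4 * e₀), (div_mul_cancel₀ e₂ hs).symm⟩
  have hx0 : x ≠ 0 := by
    rintro rfl
    exact he₂ (by rw [hx]; ring)
  have he₁ : e₁ = e₀ * x ^ 2 := by
    refine (mul_right_cancel₀ (pow_ne_zero 2 hs) ?_).symm
    rw [← hcl, hx]
    ring
  have ha₀ : a₀ = (e₀ * x ^ 4 - 8 * e₀) / 4 := by
    have h := mul_left_cancel₀ he₀
      (show e₀ * (4 * a₀) = e₀ * (e₀ * x ^ 4 - 8 * e₀) by
        rw [he₁] at h₁; linear_combination -h₁)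
    linear_combination h / 4
  have he₂ : e₂ = e₀ * x * (x ^ 2 + 4) := by rw [hx, he₁]; ring
  subst he₁ he₂ ha₀
  -- (iv) `x² ≠ 4` from the level-`2` discriminant, and `d₃² = e₀²x(x² + 4)(x + 2)⁴`
  have hx4 : x ^ 2 - 4 ≠ 0 := by
    intro h
    apply n₂
    linear_combination (e₀ ^ 2 * (x ^ 2 - 4) ^ 3 / 16) * h
  have hd : d₃ ^ 2 = e₀ ^ 2 * x * (x ^ 2 + 4) * (x + 2) ^ 4 := by rw [h₃]; ring
  -- (v) Fermat
  exact false_of_sq_eq_twoChain he₀ hx0 hx4 hd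

end Summit.ABC.ABC.Theorems

end
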